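import Summits.QuantumFields.YangMills.Theorems.BalabanUVNodesN09NestingOfHierAxial

/-!
# NODE N09 — door v1.3 (F-I-χ «ρ-edition»), KERNEL 1: «AVERAGED MINIMISERS OF MEMBERSHIP DATA ARE MEMBERSHIP DATA» — the level nesting of [I] p. 260's membership domain
# `{V | U_k(V) ∈ 𝔘_k(ρ)}` from [B11]'s restriction ∕ uniqueness rows (`hres`, `huniq`) and [B7] Prop. 2 (53), over a GENERIC domain family, with the membership radius `ρ` a letter

TRACK A (YM-PLAN §2d, node N09 of 28), seat `pub-ymgap-dag-n09-w1` (D-0149 width seat 1∕4), generation g8 — director-ym №313 (R2)∕(R3): design of record for FLAG №7′'s cure road = door v1.3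
F-I-χ «ρ-edition» (`HOME/pub-ymgap-dag-n09-w1/DESIGN-MEMO-door-v1.3.md` §5), (G-a) typing GO.  Key of record K1⁹ `StabilityBRunRowsAtRecordR13SepCoPHV` = stmt-QuantumFields-27364
(`--supports … --as helper`, count-neutral).  [I] = [Balaban1987RG1] (CMP 109), [B11] = [Balaban1985Variational] (CMP 102), [B7] = [Balaban1985Averaging] (CMP 98).
Imports this seat's g2 `…N09NestingOfHierAxial` (⇒ FILES 1–2 `…BackgroundRadiiTransfer(Restrict)`, dag-n21-c `…N21AveragedDatumRegularity`).  THEOREMS ONLY (0 `def`, 0 `sorry`).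

WHY.  Door v1.2 keys (1.1) on the second-form set `domAltOfRecord θ.ν` and NESTS the averaged minimisers `Ū^{i+1}(U_k V)` into `domAlt_{i+1}` by [B7] Prop. 2 (53) read at the SEARCH radius
`εbg` (g2 `iterUk_mem_domAlt_of_ukExists`, row `2εbg ≤ ν.ε₀L²`).  The memo's located invariants (`…N09Reg8RowAtEqualRadiiLocated` §3) show that no plaquette-keyed domain is nesting-closed under
[B11]'s window and that a second, small MEMBERSHIP radius `ρ` is needed; door v1.3 keys (1.1) on the membership domain `domU^ρ_k = {V ∈ domAlt_k | UkExists k εbg V ∧ UniqueUkOrbit k εbg V ∧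
Uk k εbg V ∈ bgReg k ρ}` (Node00 def `domUOfRecord`, filed separately).  THIS FILE is the nesting kernel, typed over a GENERIC family `dom` so that it lands independently of the def:
* §1 radius-`ρ` averaging regularity: `plaqSmall_iter_Uk_of_mem_bgReg` ∕ ★ `iterUk_mem_domAlt_of_Uk_mem_bgReg` — `Ū^j(U_k V) ∈ domAlt_j` for `j < k` from `U_k V ∈ bgReg_k(ρ)` + [B7]-numerics ON `ρ` +
  `2ρ ≤ ν.ε₀L²` (g2's §1 with `εbg ↦ ρ`: the membership radius, not the search radius, drives Prop. 2).
* §2 ★★ the three (1.1)∕membership conjuncts of the averaged datum `W := Ū^{j+1}(U_k V)` from `hres`∕`huniq` AT `V` and `U_k V ∈ bgReg_k(ρ)`: `UkExists (j+1) εbg W` (witness `U_k V`),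
  `UniqueUkOrbit (j+1) εbg W` (= `huniq`), `Uk (j+1) εbg W ∈ bgReg (j+1) ρ` (orbit-related to `U_k V ∈ bgReg_k(ρ) ⊆ bgReg_{j+1}(ρ)`; FILE 1 `mem_bgReg_iff_of_orbitRel`, FILE 2 `bgReg_anti_level`).
* §3 ★★★ `iterUk_mem_dom_of_memChar` — for ANY family `dom` CHARACTERISED by the four conjuncts (`hdom`), membership data nest: `V ∈ dom k`, `j < k` ⇒ `Ū^{j+1}(U_k V) ∈ dom (j+1)`, displayed:
  `hres`, `huniq` over `dom` ([B11], N07's slot — inside [B11]'s printed window iff `2B₃ρ ≤ a₀L²`, `2ρ ≤ a₁L²`, `εbg ≤ a₀`), `0 ≤ ρ`, [B7]-numerics on `ρ`, `2ρ ≤ ν.ε₀L²`; and the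
  corresponding `haxcrit_of_haxDom_of_memChar` (FILE 4's `haxcrit` input from on-`dom` axiality).  NO (8)-membership row, NO `h11` row: both are conjuncts of `dom`.
HONEST FRAMING: count-neutral kernel bookkeeping BY NAME; NOTHING of Bałaban's asserted ([B11]'s `hres`∕`huniq` are DISPLAYED; [B7] Prop. 2 (53) at NODE 00's averaging IS a tree theorem,
dag-n21-c); no carrier re-pointed; no record core edited ((D1′) deferred, №313 (R4)); N09 ∕ N07 ∕ N24 NOT discharged; K0⁷ ∕ K1⁹ ∕ K3⁸ NOT closed; counts unmoved (typed 28∕28 · discharged 8∕28);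
one finite four-torus programme at fixed ε — R4 closes the conditional rung `BalabanLadder.UV` only; the Yang–Mills mass gap (Clay) is NOT proved by any of this; nothing continuum ∕ ℝ⁴ ∕ OS.
-/

noncomputable section

namespace Summit.QuantumFields.YangMills.BalabanUVNodes.N09MembershipNestingKernel

open Literature.MathematicalPhysics.QuantumFieldTheory.Balaban1983to89
open Literature.MathematicalPhysics.QuantumFieldTheory.Balaban1983to89.T4Continuum (T4Family)
open Literature.MathematicalPhysics.QuantumFieldTheory.Balaban1983to89.Node00
open Literature.MathematicalPhysics.QuantumFieldTheory.Balaban1983to89.ExpMeanLog (deltaSU)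
open Summit.QuantumFields.YangMills.BalabanUVNodes.N09BackgroundRadiiTransfer (mem_bgReg_iff_of_orbitRel)
open Summit.QuantumFields.YangMills.BalabanUVNodes.N09BackgroundRadiiTransferRestrict (bgReg_anti_level)
open Summit.QuantumFields.YangMills.BalabanUVNodes.N09NestingOfHierAxial (pow_mul_eta_le_inv)
open Summit.QuantumFields.YangMills.Theorems.N21AveragedDatumRegularity (plaqSmall_iter_avOfRecord_level)

variable {F : T4Family} {N : ℕ} [NeZero N]

/-! ## §1. [B7] Prop. 2 (53) read at the MEMBERSHIP radius `ρ` -/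

/-- **EVERY PARTIAL AVERAGE OF A `ρ`-REGULAR BACKGROUND IS `2ρ(L^jη_k)²`-SMALL**: dag-n21-c's `plaqSmall_iter_avOfRecord_level` ([B7] Prop. 2 (53) at NODE 00's averaging) at the
configuration `U_k^{(εbg)} V ∈ bgReg_k(ρ)` — the membership radius `ρ`, not the search radius `εbg`, is what the estimate reads. [cite: Balaban1985Averaging, Prop. 2 (53) p.26; Balaban1987RG1, (1.2) p.260] -/
theorem plaqSmall_iter_Uk_of_mem_bgReg {K k : ℕ} {εbg ρ : ℝ} (hρ : 0 < ρ)
    (hρ3 : (143 * (((((F.P K).d + 4 : ℕ) : ℝ)) ^ 2 / 4) ^ 2) * ρ ≤ 1 / 3)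
    (hρ2 : 2 * ρ ≤ 2 * deltaSU (Fin N) / ((((F.P K).d + 4) * (F.P K).L : ℕ) : ℝ) ^ 2)
    {V : GaugeField (F.P K) k (SU N)} (hmem : Uk F N K k εbg V ∈ bgReg F N K k ρ) {j : ℕ} (hj : j ≤ k) :
    PlaqSmall (2 * ρ * (((F.P K).L : ℝ) ^ j * (F.P K).eta k) ^ 2) (Averaging.iter (avOfRecord F N K) j (Uk F N K k εbg V)) :=
  plaqSmall_iter_avOfRecord_level K k hρ hρ3 hρ2 ((mem_bgReg_iff F N K k ρ _).1 hmem) hj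

/-- ★ **AVERAGES OF A `ρ`-REGULAR BACKGROUND ARE SECOND-FORM SMALL FIELDS**: `Ū^j(U_k^{(εbg)} V) ∈ domAltOfRecord ν K j` for `j < k`, from `U_k^{(εbg)} V ∈ bgReg_k(ρ)`, the [B7]-numerics
on `ρ` and `2ρ ≤ ν.ε₀·L²` (`(L^jη_k)² ≤ L⁻²`, g2's `pow_mul_eta_le_inv`).  g2's `iterUk_mem_domAlt_of_ukExists` is the case `ρ = εbg`.
[cite: Balaban1985Averaging, Prop. 2 (53) p.26; Balaban1987RG1, (1.2) p.260 and p.259] -/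
theorem iterUk_mem_domAlt_of_Uk_mem_bgReg (ν : Stage7Numerics) {K k : ℕ} {εbg ρ : ℝ} (hρ : 0 < ρ)
    (hρ3 : (143 * (((((F.P K).d + 4 : ℕ) : ℝ)) ^ 2 / 4) ^ 2) * ρ ≤ 1 / 3)
    (hρ2 : 2 * ρ ≤ 2 * deltaSU (Fin N) / ((((F.P K).d + 4) * (F.P K).L : ℕ) : ℝ) ^ 2) (hρ₀ : 2 * ρ ≤ ν.ε₀ * ((F.P K).L : ℝ) ^ 2)
    {V : GaugeField (F.P K) k (SU N)} (hmem : Uk F N K k εbg V ∈ bgReg F N K k ρ) {j : ℕ} (hj : j < k) :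
    Averaging.iter (avOfRecord F N K) j (Uk F N K k εbg V) ∈ domAltOfRecord F N ν K j := by
  rw [mem_domAltOfRecord_iff]
  have h := plaqSmall_iter_Uk_of_mem_bgReg hρ hρ3 hρ2 hmem hj.le
  have hL0 : (0 : ℝ) < (F.P K).L := by have := (F.P K).L_pos; exact_mod_cast this
  have hη0 : 0 ≤ ((F.P K).L : ℝ) ^ j * (F.P K).eta k := by unfold Params.eta; positivity
  have hsq : (((F.P K).L : ℝ) ^ j * (F.P K).eta k) ^ 2 ≤ (((F.P K).L : ℝ)⁻¹) ^ 2 := pow_le_pow_left₀ hη0 (pow_mul_eta_le_inv hj) 2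
  have hbound : 2 * ρ * (((F.P K).L : ℝ) ^ j * (F.P K).eta k) ^ 2 ≤ ν.ε₀ := by
    calc 2 * ρ * (((F.P K).L : ℝ) ^ j * (F.P K).eta k) ^ 2 ≤ 2 * ρ * (((F.P K).L : ℝ)⁻¹) ^ 2 := by gcongr
      _ = 2 * ρ / ((F.P K).L : ℝ) ^ 2 := by rw [inv_pow, div_eq_mul_inv]
      _ ≤ ν.ε₀ := by rw [div_le_iff₀ (by positivity)]; exact hρ₀
  exact fun p => (h p).trans_le hbound

/-- The top datum: `V = Ū^k(U_k V)` is `2ρ`-small when its background of record is `ρ`-regular ([B7] (54) at the record: `L^kη_k = 1`) — the membership domain lies inside the OUTER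
second-form set of threshold `2ρ` ([I] p. 260 «implies |V(∂p′) − 1| < 2ε₀»). [cite: Balaban1985Averaging, Prop. 2 (53)–(54) p.26; Balaban1987RG1, (1.2) p.260] -/
theorem plaqSmall_two_mul_of_Uk_mem_bgReg {K k : ℕ} {εbg ρ : ℝ} (hρ : 0 < ρ)
    (hρ3 : (143 * (((((F.P K).d + 4 : ℕ) : ℝ)) ^ 2 / 4) ^ 2) * ρ ≤ 1 / 3)
    (hρ2 : 2 * ρ ≤ 2 * deltaSU (Fin N) / ((((F.P K).d + 4) * (F.P K).L : ℕ) : ℝ) ^ 2)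
    {V : GaugeField (F.P K) k (SU N)} (hex : UkExists F N K k εbg V) (hmem : Uk F N K k εbg V ∈ bgReg F N K k ρ) : PlaqSmall (2 * ρ) V := by
  have hL : ((F.P K).L : ℝ) ^ k * (F.P K).eta k = 1 := by
    rw [Params.eta, inv_pow]
    exact mul_inv_cancel₀ (pow_ne_zero _ (Nat.cast_ne_zero.mpr (ne_of_gt (F.P K).L_pos)))
  have hk := plaqSmall_iter_Uk_of_mem_bgReg hρ hρ3 hρ2 hmem le_rfl
  rw [iter_Uk hex, hL, one_pow, mul_one] at hk
  exact hk

/-! ## §2. The (1.1)∕membership conjuncts of the averaged datum, from `hres`∕`huniq` at `V` -/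

/-- **THE AVERAGED DATUM IS SOLVABLE** at radius `εbg`, level `j+1` — witness: the background itself (`hres` at `V`: «the global minimiser restricts»).
[cite: Balaban1985Variational, Thm 1 (8)–(10) p.279; Balaban1987RG1, (1.1) p.260 and (2.2)–(2.3) p.265] -/
theorem ukExists_iter_of_isBackground {K k j : ℕ} {εbg : ℝ} {V : GaugeField (F.P K) k (SU N)}
    (hB : IsBackground (avOfRecord F N K) (bgReg F N K (j + 1) εbg) (j + 1) (Averaging.iter (avOfRecord F N K) (j + 1) (Uk F N K k εbg V)) (Uk F N K k εbg V)) :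
    UkExists F N K (j + 1) εbg (Averaging.iter (avOfRecord F N K) (j + 1) (Uk F N K k εbg V)) :=
  ⟨_, hB⟩

/-- ★★ **THE MINIMISER OF RECORD OVER THE AVERAGED DATUM IS `ρ`-REGULAR**: if `U_k V` restricts at level `j+1` (`hres` at `V`), the minimal orbit there is unique (`huniq` at `V`), and
`U_k V ∈ bgReg_k(ρ)` with `0 ≤ ρ`, then `Uk (j+1) εbg (Ū^{j+1}(U_k V)) ∈ bgReg (j+1) ρ` — the chosen minimiser is a residual transform of `U_k V` (uniqueness), which is `ρ`-regular at level
`k ≥ j+1` hence at level `j+1` (FILE 2 `bgReg_anti_level`), and plaquette classes are orbit-invariant (FILE 1 `mem_bgReg_iff_of_orbitRel`).  This is the step that makes the MEMBERSHIP domain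
nesting-closed WITHOUT any plaquette threshold. [cite: Balaban1985Variational, Thm 1 (6) and (8) p.279; Balaban1987RG1, (1.1)–(1.2) p.260 and (2.3) p.265] -/
theorem Uk_iter_mem_bgReg_of_isBackground_of_unique {K k j : ℕ} (hjk : j + 1 ≤ k) {εbg ρ : ℝ} (hρ : 0 ≤ ρ) {V : GaugeField (F.P K) k (SU N)}
    (hB : IsBackground (avOfRecord F N K) (bgReg F N K (j + 1) εbg) (j + 1) (Averaging.iter (avOfRecord F N K) (j + 1) (Uk F N K k εbg V)) (Uk F N K k εbg V))
    (hU : UniqueUkOrbit F N K (j + 1) εbg (Averaging.iter (avOfRecord F N K) (j + 1) (Uk F N K k εbg V)))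
    (hmem : Uk F N K k εbg V ∈ bgReg F N K k ρ) :
    Uk F N K (j + 1) εbg (Averaging.iter (avOfRecord F N K) (j + 1) (Uk F N K k εbg V)) ∈ bgReg F N K (j + 1) ρ := by
  have hrel : B12GaugeOrbits021.OrbitRel (j + 1) (Uk F N K k εbg V)
      (Uk F N K (j + 1) εbg (Averaging.iter (avOfRecord F N K) (j + 1) (Uk F N K k εbg V))) :=
    hU _ _ hB (isBackground_Uk ⟨_, hB⟩)
  exact (mem_bgReg_iff_of_orbitRel hrel).1 (bgReg_anti_level hjk hρ hmem)

/-! ## §3. Membership data nest, for any family characterised by the four conjuncts -/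

/-- ★★★ **«AVERAGED MINIMISERS OF MEMBERSHIP DATA ARE MEMBERSHIP DATA»**: let `dom : (k : ℕ) → Set _` be ANY family characterised by
`V ∈ dom k ↔ V ∈ domAltOfRecord ν K k ∧ UkExists K k εbg V ∧ UniqueUkOrbit K k εbg V ∧ Uk K k εbg V ∈ bgReg K k ρ` (`hdom`; Node00's `domUOfRecord ν εbg ρ K` is one).  IF on `dom` the
global minimiser restricts (`hres`, [B11] Thm 1 (8)–(10)) with unique minimal orbits along its averages (`huniq`, [B11] Thm 1 (6)) — N07's two rows, DISPLAYED — and `0 < ρ` satisfies the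
[B7]-numerics and `2ρ ≤ ν.ε₀L²`, THEN for every `V ∈ dom k`, `k ≤ K`, `j < k`: `Ū^{j+1}(U_k V) ∈ dom (j+1)`.  (Top case `j+1 = k`: `Ū^k(U_k V) = V`.)  No (8)-row, no `h11`, no plaquette
threshold on the data beyond conjunct 1.  CONDITIONAL on `hres`∕`huniq`; nothing of Bałaban asserted.
[cite: Balaban1987RG1, (1.1)–(1.2) p.260, (2.2)–(2.3) p.265 and p.259; Balaban1985Variational, Thm 1 (6), (8)–(10) p.279; Balaban1985Averaging, Prop. 2 (53) p.26] -/
theorem iterUk_mem_dom_of_memChar (ν : Stage7Numerics) {K : ℕ} {εbg ρ : ℝ} {dom : (k : ℕ) → Set (GaugeField (F.P K) k (SU N))}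
    (hdom : ∀ k (V : GaugeField (F.P K) k (SU N)), V ∈ dom k ↔
      V ∈ domAltOfRecord F N ν K k ∧ UkExists F N K k εbg V ∧ UniqueUkOrbit F N K k εbg V ∧ Uk F N K k εbg V ∈ bgReg F N K k ρ)
    (hres : ∀ k, k ≤ K → HRestrict F N εbg K k (dom k))
    (huniq : ∀ k, k ≤ K → ∀ V ∈ dom k, ∀ j < k, UniqueUkOrbit F N K (j + 1) εbg (Averaging.iter (avOfRecord F N K) (j + 1) (Uk F N K k εbg V)))
    (hρ : 0 < ρ) (hρ3 : (143 * (((((F.P K).d + 4 : ℕ) : ℝ)) ^ 2 / 4) ^ 2) * ρ ≤ 1 / 3)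
    (hρ2 : 2 * ρ ≤ 2 * deltaSU (Fin N) / ((((F.P K).d + 4) * (F.P K).L : ℕ) : ℝ) ^ 2) (hρ₀ : 2 * ρ ≤ ν.ε₀ * ((F.P K).L : ℝ) ^ 2) :
    ∀ k, k ≤ K → ∀ V ∈ dom k, ∀ j < k, Averaging.iter (avOfRecord F N K) (j + 1) (Uk F N K k εbg V) ∈ dom (j + 1) := by
  intro k hk V hV j hj
  obtain ⟨-, hex, -, hmem⟩ := (hdom k V).1 hV
  rcases Nat.lt_or_ge (j + 1) k with h | h
  · have hB := hres k hk V hV j hj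
    exact (hdom (j + 1) _).2 ⟨iterUk_mem_domAlt_of_Uk_mem_bgReg ν hρ hρ3 hρ2 hρ₀ hmem h, ukExists_iter_of_isBackground hB, huniq k hk V hV j hj,
      Uk_iter_mem_bgReg_of_isBackground_of_unique (by omega) hρ.le hB (huniq k hk V hV j hj) hmem⟩
  · obtain rfl : k = j + 1 := le_antisymm h hj
    rw [iter_Uk hex]
    exact hV

/-- The `∀ j < k, Ū^j(U_k V) ∈ dom j ∪ {j = 0}`-free form a consumer of FILE 5's engine wants for its bookkeeping sets: every average of POSITIVE level below the top is a member.
[cite: Balaban1987RG1, (1.1)–(1.2) p.260 and (2.3) p.265 (bookkeeping)] -/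
theorem iterUk_succ_mem_dom_of_memChar (ν : Stage7Numerics) {K : ℕ} {εbg ρ : ℝ} {dom : (k : ℕ) → Set (GaugeField (F.P K) k (SU N))}
    (hdom : ∀ k (V : GaugeField (F.P K) k (SU N)), V ∈ dom k ↔
      V ∈ domAltOfRecord F N ν K k ∧ UkExists F N K k εbg V ∧ UniqueUkOrbit F N K k εbg V ∧ Uk F N K k εbg V ∈ bgReg F N K k ρ)
    (hres : ∀ k, k ≤ K → HRestrict F N εbg K k (dom k))
    (huniq : ∀ k, k ≤ K → ∀ V ∈ dom k, ∀ j < k, UniqueUkOrbit F N K (j + 1) εbg (Averaging.iter (avOfRecord F N K) (j + 1) (Uk F N K k εbg V)))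
    (hρ : 0 < ρ) (hρ3 : (143 * (((((F.P K).d + 4 : ℕ) : ℝ)) ^ 2 / 4) ^ 2) * ρ ≤ 1 / 3)
    (hρ2 : 2 * ρ ≤ 2 * deltaSU (Fin N) / ((((F.P K).d + 4) * (F.P K).L : ℕ) : ℝ) ^ 2) (hρ₀ : 2 * ρ ≤ ν.ε₀ * ((F.P K).L : ℝ) ^ 2) :
    ∀ k, k ≤ K → ∀ V ∈ dom k, ∀ i, i + 1 < k → Averaging.iter (avOfRecord F N K) (i + 1) (Uk F N K k εbg V) ∈ dom (i + 1) :=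
  fun k hk V hV i hi => iterUk_mem_dom_of_memChar ν hdom hres huniq hρ hρ3 hρ2 hρ₀ k hk V hV i (by omega)

/-- ★ **FILE 4's INPUT `haxcrit` FROM ON-`dom` AXIALITY** (g2's `haxcrit_of_haxDom` for a membership family): if the record's critical configuration is `cd j`-axial over every member of
`dom (j+1)` (n09-w2 g2's convention `haxDom`, re-keyed), then it is so over the averages `Ū^{j+1}(U_k V)` of members — they ARE members (§3). [cite: Balaban1987RG1, (2.3) p.265 (bookkeeping)] -/
theorem haxcrit_of_haxDom_of_memChar (ν : Stage7Numerics) {K : ℕ} {εbg ρ : ℝ} {dom : (k : ℕ) → Set (GaugeField (F.P K) k (SU N))}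
    (cd : (j : ℕ) → ContourData (F.P K) j (SU N))
    (hdom : ∀ k (V : GaugeField (F.P K) k (SU N)), V ∈ dom k ↔
      V ∈ domAltOfRecord F N ν K k ∧ UkExists F N K k εbg V ∧ UniqueUkOrbit F N K k εbg V ∧ Uk F N K k εbg V ∈ bgReg F N K k ρ)
    (hres : ∀ k, k ≤ K → HRestrict F N εbg K k (dom k))
    (huniq : ∀ k, k ≤ K → ∀ V ∈ dom k, ∀ j < k, UniqueUkOrbit F N K (j + 1) εbg (Averaging.iter (avOfRecord F N K) (j + 1) (Uk F N K k εbg V)))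
    (hρ : 0 < ρ) (hρ3 : (143 * (((((F.P K).d + 4 : ℕ) : ℝ)) ^ 2 / 4) ^ 2) * ρ ≤ 1 / 3)
    (hρ2 : 2 * ρ ≤ 2 * deltaSU (Fin N) / ((((F.P K).d + 4) * (F.P K).L : ℕ) : ℝ) ^ 2) (hρ₀ : 2 * ρ ≤ ν.ε₀ * ((F.P K).L : ℝ) ^ 2)
    (haxDom : ∀ j < K, ∀ W ∈ dom (j + 1), AxialGauge (cd j) (critCfgOfRecord F N ν K j W)) :
    ∀ k, k ≤ K → ∀ V ∈ dom k, ∀ j < k, AxialGauge (cd j) (critCfgOfRecord F N ν K j (Averaging.iter (avOfRecord F N K) (j + 1) (Uk F N K k εbg V))) :=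
  fun k hk V hV j hj => haxDom j (by omega) _ (iterUk_mem_dom_of_memChar ν hdom hres huniq hρ hρ3 hρ2 hρ₀ k hk V hV j hj)

/-- **THE MEMBERSHIP FAMILY LIES IN THE OUTER SECOND-FORM SET OF THRESHOLD `2ρ`** (for a consumer comparing with [I] p. 260's outer domain): every `V ∈ dom k` is `2ρ`-small.
[cite: Balaban1985Averaging, Prop. 2 (53)–(54) p.26; Balaban1987RG1, (1.2) p.260] -/
theorem plaqSmall_two_mul_of_memChar (ν : Stage7Numerics) {K : ℕ} {εbg ρ : ℝ} {dom : (k : ℕ) → Set (GaugeField (F.P K) k (SU N))}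
    (hdom : ∀ k (V : GaugeField (F.P K) k (SU N)), V ∈ dom k ↔
      V ∈ domAltOfRecord F N ν K k ∧ UkExists F N K k εbg V ∧ UniqueUkOrbit F N K k εbg V ∧ Uk F N K k εbg V ∈ bgReg F N K k ρ)
    (hρ : 0 < ρ) (hρ3 : (143 * (((((F.P K).d + 4 : ℕ) : ℝ)) ^ 2 / 4) ^ 2) * ρ ≤ 1 / 3)
    (hρ2 : 2 * ρ ≤ 2 * deltaSU (Fin N) / ((((F.P K).d + 4) * (F.P K).L : ℕ) : ℝ) ^ 2) {k : ℕ} {V : GaugeField (F.P K) k (SU N)} (hV : V ∈ dom k) :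
    PlaqSmall (2 * ρ) V := by
  obtain ⟨-, hex, -, hmem⟩ := (hdom k V).1 hV
  exact plaqSmall_two_mul_of_Uk_mem_bgReg hρ hρ3 hρ2 hex hmem

end Summit.QuantumFields.YangMills.BalabanUVNodes.N09MembershipNestingKernel

end
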